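import Literature.Analysis.FluidPDE.TorusNSBoundedTrajectorySet
import Literature.Analysis.FunctionSpaces.TorusGevreySobolevBounds
import HarnessLib

/-!
# Continuity of the solution map and of the enstrophy on the set of bounded Gevrey trajectory states

Analysis/FluidPDE proof file (theorems only; no definitions, no named facts), companion of
`TorusNSBoundedTrajectorySet`. With `ν > 0`, a steady force `F`, an enstrophy level `R` and Gevrey constants
`σ > 0`, `C`, let `K₁ ⊆ H = Torus.energySpace d` be the set of states of global classical mean-zero
solutions of NS_ν(F) with `‖∇u(t)‖₂² ≤ R` and `∑_{k∈S} e^{2σ|k|}‖û(t)(k)‖² ≤ C` for all `t ≥ 0` (given, as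
there, through its membership characterisation `hK₁`). On `K₁` the `L²` topology of `H` controls the `H¹`
topology of the data — the uniform Gevrey bound gives a uniform `H²` bound
(`Torus.exists_sobolevBounds_of_gevreyBound`, E11) and `‖∇v‖₂² ≤ ‖v‖₂‖Δv‖₂`
(`Torus.gradNormSq_le_sqrt_integral_mul_sqrt_integral_laplacian`) — whence:

* `Torus.exists_gradNormSq_sub_le_of_gevreyBound` — `‖∇(v − w)‖₂² ≤ L ‖v − w‖₂` for smooth fields in a
  Gevrey ball, `L = L(σ, C)`;
* `Torus.continuousOn_trajectorySet_of_eq_gradNormSq` — any real function on `H` reading `‖∇v‖₂²` on the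
  smooth representatives of the states of `K₁` (the enstrophy observable) is continuous on `K₁`;
* `Torus.IsClassicalNSSolutionOn.tendsto_state_nhdsWithin` — the state curve of a classical solution on
  `[0, ∞)` is continuous in `H` (uniform continuity in time of jointly smooth fields);
* `Torus.continuousOn_solutionMap_trajectorySet` — **any map `Φ : ℝ → H → H` which on `K₁` follows the
  classical trajectories (`Φ t x =ᵐ u(t)`) is jointly continuous on `[0, ∞) × K₁`** (`card d = 3`): in the
  state variable by the `V`-stability estimate
  `Torus.IsClassicalNSSolutionOn.h1_sub_le_mul_of_integral_laplacian_sq_le` (E3) on `[0, t₀ + 1]` fed with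
  `H¹`-closeness of the data, in the time variable by the previous item.

These are the continuity properties of the strong-solution semiflow on bounded invariant sets of `V`
(Robinson–Rodrigo–Sadowski 2016, Thm 6.10; Constantin–Foias 1988, Thm 10.2 / Ch. 14) in the form consumed by
the enlarged-phase construction of the line `ergodic-budget-selection-closing`. Deliberately NOT here:
semigroup properties, invariant measures.

## References

* J. C. Robinson, J. L. Rodrigo, W. Sadowski, *The Three-Dimensional Navier–Stokes Equations*, CUP 2016,
  Thm 6.10. [RobinsonRodrigoSadowskiCUP2016]
* P. Constantin, C. Foias, *Navier–Stokes Equations*, Univ. Chicago Press 1988, Ch. 10 Thm 10.2.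
  [ConstantinFoiasNSE1988]
-/

noncomputable section

open MeasureTheory Set Function Filter UnitAddTorus
open scoped ContDiff InnerProductSpace Topology NNReal ENNReal

namespace Literature.Analysis.FluidPDE

open Literature.Analysis.FunctionSpaces

variable {d : Type*} [Fintype d] [DecidableEq d]

/-! ### `L²`-closeness controls `H¹`-closeness in a Gevrey ball -/

section GevreyBall

/-- **In a Gevrey ball, `L²`-close smooth fields are `H¹`-close**: for `σ > 0` and `C` there is `L ≥ 0` with
`‖∇(v − w)‖₂² ≤ L ‖v − w‖₂` for all smooth `v, w` obeying `∑_{k∈S} e^{2σ|k|}‖·̂(k)‖² ≤ C` (interpolation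
`‖∇g‖₂² ≤ ‖g‖₂‖Δg‖₂` with `g = v − w` and the uniform bound `∫‖Δ·‖² ≤ B(σ, C)` of
`Torus.exists_sobolevBounds_of_gevreyBound`; `L = √(4B)`). [folklore] -/
theorem Torus.exists_gradNormSq_sub_le_of_gevreyBound {σ : ℝ} (hσ : 0 < σ) (C : ℝ) :
    ∃ L : ℝ, 0 ≤ L ∧ ∀ (v w : UnitAddTorus d → EuclideanSpace ℝ d), Torus.IsSmooth v → Torus.IsSmooth w →
      (∀ S : Finset (d → ℤ), ∑ k ∈ S, Real.exp (2 * σ * Real.sqrt (Torus.freqNormSq k)) *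
        ‖mFourierCoeff (EuclideanSpace.complexify ∘ v) k‖ ^ 2 ≤ C) →
      (∀ S : Finset (d → ℤ), ∑ k ∈ S, Real.exp (2 * σ * Real.sqrt (Torus.freqNormSq k)) *
        ‖mFourierCoeff (EuclideanSpace.complexify ∘ w) k‖ ^ 2 ≤ C) →
      Torus.gradNormSq (fun x => v x - w x) ≤ L * Real.sqrt (∫ x, ‖v x - w x‖ ^ 2) := by
  obtain ⟨B, hB⟩ := Torus.exists_sobolevBounds_of_gevreyBound (d := d) hσ C
  refine ⟨Real.sqrt (4 * B), Real.sqrt_nonneg _, fun v w hv hw hGv hGw => ?_⟩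
  have hvw : Torus.IsSmooth (fun x => v x - w x) := hv.sub hw
  have hΔ : ∫ x, ‖Torus.laplacian (fun x => v x - w x) x‖ ^ 2 ≤ 4 * B := by
    have hsub : Torus.laplacian (fun x => v x - w x) = fun x => Torus.laplacian v x - Torus.laplacian w x := by
      rw [show (fun x => v x - w x) = v - w from rfl, Torus.laplacian_sub hv hw]
      rfl
    rw [hsub]
    have h1 := Literature.Analysis.FunctionSpaces.Torus.integral_norm_sub_sq_le_two_mul
      (v := fun _ => (0 : EuclideanSpace ℝ d)) hv.laplacian.continuous continuous_const hw.laplacian.continuous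
    simp only [sub_zero, zero_sub, norm_neg] at h1
    linarith [(hB v hv hGv).2.2.2.1, (hB w hw hGw).2.2.2.1]
  calc Torus.gradNormSq (fun x => v x - w x)
      ≤ Real.sqrt (∫ x, ‖v x - w x‖ ^ 2) * Real.sqrt (∫ x, ‖Torus.laplacian (fun x => v x - w x) x‖ ^ 2) :=
        Torus.gradNormSq_le_sqrt_integral_mul_sqrt_integral_laplacian hvw
    _ ≤ Real.sqrt (∫ x, ‖v x - w x‖ ^ 2) * Real.sqrt (4 * B) :=
        mul_le_mul_of_nonneg_left (Real.sqrt_le_sqrt hΔ) (Real.sqrt_nonneg _)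
    _ = Real.sqrt (4 * B) * Real.sqrt (∫ x, ‖v x - w x‖ ^ 2) := mul_comm _ _

end GevreyBall

/-! ### Continuity on the trajectory set -/

section TrajectorySet

variable {ν R σ C : ℝ} {F : UnitAddTorus d → EuclideanSpace ℝ d} {K₁ : Set (Torus.energySpace d)}

/-- **The enstrophy is continuous on `K₁`** (in the topology of `H`). If `e : H → ℝ` reads `‖∇v‖₂²` on
every smooth representative `v` of a state of `K₁` (the enstrophy observable), then `e` is continuous on
`K₁`: for trajectories `u`, `u₀` of `x`, `x₀ ∈ K₁`, `|‖∇u(0)‖₂ − ‖∇u₀(0)‖₂| ≤ ‖∇(u(0) − u₀(0))‖₂`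
(Minkowski) `≤ (L‖x − x₀‖)^{1/2}` (`Torus.exists_gradNormSq_sub_le_of_gevreyBound`), and both gradient norms
are `≤ √R`. [folklore] -/
theorem Torus.continuousOn_trajectorySet_of_eq_gradNormSq (hσ : 0 < σ)
    (hK₁ : ∀ x : Torus.energySpace d, x ∈ K₁ ↔
      ∃ (u : ℝ → UnitAddTorus d → EuclideanSpace ℝ d) (p : ℝ → UnitAddTorus d → ℝ),
        Torus.IsClassicalNSSolutionOn (Ici 0) ν (fun _ => F) u p ∧ (∀ t : ℝ, 0 ≤ t → Torus.HasZeroMean (u t)) ∧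
        (∀ t : ℝ, 0 ≤ t → Torus.gradNormSq (u t) ≤ R) ∧
        (∀ t : ℝ, 0 ≤ t → ∀ S : Finset (d → ℤ), ∑ k ∈ S, Real.exp (2 * σ * Real.sqrt (Torus.freqNormSq k)) *
          ‖mFourierCoeff (EuclideanSpace.complexify ∘ u t) k‖ ^ 2 ≤ C) ∧
        ((x : Lp (EuclideanSpace ℝ d) 2 (volume : Measure (UnitAddTorus d))) : UnitAddTorus d → EuclideanSpace ℝ d)
          =ᵐ[volume] u 0)
    (e : Torus.energySpace d → ℝ)
    (he : ∀ x ∈ K₁, ∀ v : UnitAddTorus d → EuclideanSpace ℝ d, Torus.IsSmooth v →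
      ((x : Lp (EuclideanSpace ℝ d) 2 (volume : Measure (UnitAddTorus d))) : UnitAddTorus d → EuclideanSpace ℝ d)
        =ᵐ[volume] v → e x = Torus.gradNormSq v) :
    ContinuousOn e K₁ := by
  obtain ⟨L, hL0, hL⟩ := Torus.exists_gradNormSq_sub_le_of_gevreyBound (d := d) hσ C
  intro x₀ hx₀
  obtain ⟨u₀, p₀, hu₀, -, hu₀R, hu₀G, hx₀rep⟩ := (hK₁ x₀).1 hx₀
  have hsm₀ : Torus.IsSmooth (u₀ 0) := hu₀.smooth_velocity.isSmooth_slice (mem_Ici.2 le_rfl)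
  have he₀ : e x₀ = Torus.gradNormSq (u₀ 0) := he x₀ hx₀ (u₀ 0) hsm₀ hx₀rep
  -- the modulus of continuity at `x₀`
  have hbound : ∀ x ∈ K₁, |e x - e x₀| ≤ 2 * Real.sqrt R * Real.sqrt (L * ‖x - x₀‖) := by
    intro x hx
    obtain ⟨u, p, hu, -, huR, huG, hxrep⟩ := (hK₁ x).1 hx
    have hsm : Torus.IsSmooth (u 0) := hu.smooth_velocity.isSmooth_slice (mem_Ici.2 le_rfl)
    set a : ℝ := Real.sqrt (Torus.gradNormSq (u 0))
    set b : ℝ := Real.sqrt (Torus.gradNormSq (u₀ 0))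
    set δ : ℝ := Real.sqrt (Torus.gradNormSq (fun z => u 0 z - u₀ 0 z))
    have ha0 : 0 ≤ a := Real.sqrt_nonneg _
    have hb0 : 0 ≤ b := Real.sqrt_nonneg _
    have haR : a ≤ Real.sqrt R := Real.sqrt_le_sqrt (huR 0 le_rfl)
    have hbR : b ≤ Real.sqrt R := Real.sqrt_le_sqrt (hu₀R 0 le_rfl)
    have hab : a ≤ b + δ := Torus.sqrt_gradNormSq_le_sqrt_add_sqrt hsm hsm₀
    have hba : b ≤ a + δ := by
      have h := Torus.sqrt_gradNormSq_le_sqrt_add_sqrt hsm₀ hsm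
      rwa [Torus.gradNormSq_sub_comm (u₀ 0) (u 0)] at h
    have habs : |a - b| ≤ δ := abs_sub_le_iff.2 ⟨by linarith, by linarith⟩
    -- `δ² ≤ L ‖x - x₀‖`
    have hδ : δ ≤ Real.sqrt (L * ‖x - x₀‖) := by
      refine Real.sqrt_le_sqrt ?_
      have h := hL (u 0) (u₀ 0) hsm hsm₀ (huG 0 le_rfl) (hu₀G 0 le_rfl)
      rwa [← Torus.energySpace_norm_sub_sq_eq hxrep hx₀rep, Real.sqrt_sq (norm_nonneg _)] at h
    have hex : e x = a ^ 2 := by rw [he x hx (u 0) hsm hxrep, Real.sq_sqrt (Torus.gradNormSq_nonneg _)]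
    have he₀' : e x₀ = b ^ 2 := by rw [he₀, Real.sq_sqrt (Torus.gradNormSq_nonneg _)]
    rw [hex, he₀', sq_sub_sq, abs_mul, abs_of_nonneg (add_nonneg ha0 hb0)]
    calc (a + b) * |a - b| ≤ (Real.sqrt R + Real.sqrt R) * δ :=
          mul_le_mul (add_le_add haR hbR) habs (abs_nonneg _) (add_nonneg (ha0.trans haR) (hb0.trans hbR))
      _ ≤ (Real.sqrt R + Real.sqrt R) * Real.sqrt (L * ‖x - x₀‖) :=
          mul_le_mul_of_nonneg_left hδ (add_nonneg (ha0.trans haR) (hb0.trans hbR))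
      _ = 2 * Real.sqrt R * Real.sqrt (L * ‖x - x₀‖) := by ring
  -- the modulus tends to zero
  have hlim : Tendsto (fun x : Torus.energySpace d => 2 * Real.sqrt R * Real.sqrt (L * ‖x - x₀‖)) (𝓝[K₁] x₀) (𝓝 0) := by
    have hc : Continuous fun x : Torus.energySpace d => 2 * Real.sqrt R * Real.sqrt (L * ‖x - x₀‖) :=
      continuous_const.mul (Real.continuous_sqrt.comp (continuous_const.mul (continuous_id.sub continuous_const).norm))
    have h := hc.tendsto x₀
    simp only [sub_self, norm_zero, mul_zero, Real.sqrt_zero] at h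
    exact h.mono_left nhdsWithin_le_nhds
  show ContinuousWithinAt e K₁ x₀
  rw [ContinuousWithinAt, tendsto_iff_norm_sub_tendsto_zero]
  refine squeeze_zero' (Eventually.of_forall fun x => norm_nonneg _) ?_ hlim
  filter_upwards [self_mem_nhdsWithin] with x hx
  rw [Real.norm_eq_abs]
  exact hbound x hx

/-- **State curves of classical solutions are continuous in `H`.** If `Φx : ℝ → H` is represented along
a classical solution `(u, p)` on `[0, ∞) × T^d` (`Φx t =ᵐ u(t)` for `t ≥ 0`), then `Φx` is continuous within
`[0, ∞)` at every `t₀ ≥ 0`: `‖Φx t − Φx t₀‖² = ∫ ‖u(t) − u(t₀)‖²` and jointly smooth fields are uniformly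
continuous in time on the compact torus (`Torus.IsSmoothSpaceTimeOn.eventually_norm_sub_lt`). [folklore] -/
theorem _root_.Literature.Analysis.FunctionSpaces.Torus.IsClassicalNSSolutionOn.tendsto_state_nhdsWithin
    {f u : ℝ → UnitAddTorus d → EuclideanSpace ℝ d} {p : ℝ → UnitAddTorus d → ℝ}
    (hsol : Torus.IsClassicalNSSolutionOn (Ici 0) ν f u p) {Φx : ℝ → Torus.energySpace d}
    (hΦ : ∀ t : ℝ, 0 ≤ t →
      ((Φx t : Lp (EuclideanSpace ℝ d) 2 (volume : Measure (UnitAddTorus d))) : UnitAddTorus d → EuclideanSpace ℝ d)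
        =ᵐ[volume] u t)
    {t₀ : ℝ} (ht₀ : 0 ≤ t₀) : Tendsto Φx (𝓝[Ici 0] t₀) (𝓝 (Φx t₀)) := by
  rw [Metric.tendsto_nhds]
  intro ε hε
  obtain ⟨η, hη, hηε⟩ : ∃ η : ℝ, 0 < η ∧ η ^ 2 < ε ^ 2 := ⟨ε / 2, by positivity, by nlinarith⟩
  filter_upwards [hsol.smooth_velocity.eventually_norm_sub_lt (mem_Ici.2 ht₀) hη, self_mem_nhdsWithin] with t ht htS
  rw [dist_eq_norm]
  have hsq : ‖Φx t - Φx t₀‖ ^ 2 < ε ^ 2 := by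
    rw [Torus.energySpace_norm_sub_sq_eq (hΦ t (mem_Ici.1 htS)) (hΦ t₀ ht₀)]
    calc ∫ z, ‖u t z - u t₀ z‖ ^ 2 ≤ ∫ _ : UnitAddTorus d, η ^ 2 := by
          refine integral_mono_of_nonneg (Eventually.of_forall fun z => sq_nonneg _) (integrable_const _)
            (Eventually.of_forall fun z => ?_)
          exact pow_le_pow_left₀ (norm_nonneg _) (ht z).le 2
      _ = η ^ 2 := by simp
      _ < ε ^ 2 := hηε
  exact (abs_lt_of_sq_lt_sq' hsq hε.le).2

/-- **The solution map is jointly continuous on `[0, ∞) × K₁`** (`card d = 3`, `ν > 0`, `σ > 0`). Let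
`Φ : ℝ → H → H` follow, on `K₁`, the classical trajectories: for `x ∈ K₁`, every global classical
solution `(u, p)` of NS_ν(F) with `x =ᵐ u(0)` and every `t ≥ 0`, `Φ t x =ᵐ u(t)`. Then
`(t, x) ↦ Φ t x` is continuous on `Ici 0 ×ˢ K₁`. At `(t₀, x₀)`:
`‖Φ t x − Φ t₀ x₀‖ ≤ ‖Φ t x − Φ t x₀‖ + ‖Φ t x₀ − Φ t₀ x₀‖`; the second term is small by
`tendsto_state_nhdsWithin`; for `t ≤ t₀ + 1` the first is, squared, `∫‖u(t) − u₀(t)‖² ≤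
C_V (‖x − x₀‖² + ‖∇(u(0) − u₀(0))‖₂²)` by the `V`-stability estimate on `[0, t₀ + 1]` (levels `R` and
`∫₀^{t₀+1}‖Δu₀‖₂²`), and `‖∇(u(0) − u₀(0))‖₂² ≤ L‖x − x₀‖` on the Gevrey ball.
[cite: RobinsonRodrigoSadowskiCUP2016, Thm 6.10] -/
theorem Torus.continuousOn_solutionMap_trajectorySet (hd : Fintype.card d = 3) (hν : 0 < ν) (hσ : 0 < σ)
    (hK₁ : ∀ x : Torus.energySpace d, x ∈ K₁ ↔
      ∃ (u : ℝ → UnitAddTorus d → EuclideanSpace ℝ d) (p : ℝ → UnitAddTorus d → ℝ),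
        Torus.IsClassicalNSSolutionOn (Ici 0) ν (fun _ => F) u p ∧ (∀ t : ℝ, 0 ≤ t → Torus.HasZeroMean (u t)) ∧
        (∀ t : ℝ, 0 ≤ t → Torus.gradNormSq (u t) ≤ R) ∧
        (∀ t : ℝ, 0 ≤ t → ∀ S : Finset (d → ℤ), ∑ k ∈ S, Real.exp (2 * σ * Real.sqrt (Torus.freqNormSq k)) *
          ‖mFourierCoeff (EuclideanSpace.complexify ∘ u t) k‖ ^ 2 ≤ C) ∧
        ((x : Lp (EuclideanSpace ℝ d) 2 (volume : Measure (UnitAddTorus d))) : UnitAddTorus d → EuclideanSpace ℝ d)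
          =ᵐ[volume] u 0)
    (Φ : ℝ → Torus.energySpace d → Torus.energySpace d)
    (hΦ : ∀ x ∈ K₁, ∀ (u : ℝ → UnitAddTorus d → EuclideanSpace ℝ d) (p : ℝ → UnitAddTorus d → ℝ),
      Torus.IsClassicalNSSolutionOn (Ici 0) ν (fun _ => F) u p →
      ((x : Lp (EuclideanSpace ℝ d) 2 (volume : Measure (UnitAddTorus d))) : UnitAddTorus d → EuclideanSpace ℝ d)
        =ᵐ[volume] u 0 →
      ∀ t : ℝ, 0 ≤ t →
        ((Φ t x : Lp (EuclideanSpace ℝ d) 2 (volume : Measure (UnitAddTorus d))) : UnitAddTorus d → EuclideanSpace ℝ d)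
          =ᵐ[volume] u t) :
    ContinuousOn (fun q : ℝ × Torus.energySpace d => Φ q.1 q.2) (Ici 0 ×ˢ K₁) := by
  obtain ⟨L, hL0, hL⟩ := Torus.exists_gradNormSq_sub_le_of_gevreyBound (d := d) hσ C
  rintro ⟨t₀, x₀⟩ ⟨ht₀, hx₀⟩
  replace ht₀ : 0 ≤ t₀ := mem_Ici.1 ht₀
  obtain ⟨u₀, p₀, hu₀, hu₀mean, hu₀R, hu₀G, hx₀rep⟩ := (hK₁ x₀).1 hx₀
  -- the `V`-stability constant on the window `[0, t₀ + 1]` around the trajectory of `x₀`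
  set T : ℝ := t₀ + 1 with hT_def
  have hT : 0 < T := by rw [hT_def]; linarith
  set Y : ℝ := ∫ s in (0 : ℝ)..(0 + T), (∫ z, ‖Torus.laplacian (u₀ s) z‖ ^ 2)
  obtain ⟨CV, hCV⟩ := Torus.IsClassicalNSSolutionOn.h1_sub_le_mul_of_integral_laplacian_sq_le (d := d) hd hν R Y T hT
  have hwin : ∀ {u : ℝ → UnitAddTorus d → EuclideanSpace ℝ d} {p : ℝ → UnitAddTorus d → ℝ},
      Torus.IsClassicalNSSolutionOn (Ici 0) ν (fun _ => F) u p →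
      Torus.IsClassicalNSSolutionOn (Icc 0 (0 + T)) ν (fun _ => F) u p := fun h =>
    h.mono (fun s hs => mem_Ici.2 hs.1) (uniqueDiffOn_Icc (by linarith))
  -- (I) continuity in the state, uniformly for `t ∈ [0, T]`
  have hI : ∀ x ∈ K₁, ∀ t ∈ Icc 0 (0 + T), ‖Φ t x - Φ t x₀‖ ^ 2 ≤ max CV 0 * (‖x - x₀‖ ^ 2 + L * ‖x - x₀‖) := by
    intro x hx t ht
    obtain ⟨u, p, hu, humean, huR, huG, hxrep⟩ := (hK₁ x).1 hx
    have hsm : Torus.IsSmooth (u 0) := hu.smooth_velocity.isSmooth_slice (mem_Ici.2 le_rfl)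
    have hsm₀ : Torus.IsSmooth (u₀ 0) := hu₀.smooth_velocity.isSmooth_slice (mem_Ici.2 le_rfl)
    have e1 : ‖Φ t x - Φ t x₀‖ ^ 2 = ∫ z, ‖u t z - u₀ t z‖ ^ 2 :=
      Torus.energySpace_norm_sub_sq_eq (hΦ x hx u p hu hxrep t ht.1) (hΦ x₀ hx₀ u₀ p₀ hu₀ hx₀rep t ht.1)
    have e0 : ‖x - x₀‖ ^ 2 = ∫ z, ‖u 0 z - u₀ 0 z‖ ^ 2 := Torus.energySpace_norm_sub_sq_eq hxrep hx₀rep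
    have hV := hCV (hwin hu) (hwin hu₀) (fun s hs => humean s hs.1) (fun s hs => hu₀mean s hs.1)
      (fun s hs => huR s hs.1) (fun s hs => hu₀R s hs.1) le_rfl t ht
    have hg : Torus.gradNormSq (fun z => u 0 z - u₀ 0 z) ≤ L * ‖x - x₀‖ := by
      have h := hL (u 0) (u₀ 0) hsm hsm₀ (huG 0 le_rfl) (hu₀G 0 le_rfl)
      rwa [← e0, Real.sqrt_sq (norm_nonneg _)] at h
    have hnn : 0 ≤ (∫ z, ‖u 0 z - u₀ 0 z‖ ^ 2) + Torus.gradNormSq (fun z => u 0 z - u₀ 0 z) :=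
      add_nonneg (integral_nonneg fun z => sq_nonneg _) (Torus.gradNormSq_nonneg _)
    calc ‖Φ t x - Φ t x₀‖ ^ 2 = ∫ z, ‖u t z - u₀ t z‖ ^ 2 := e1
      _ ≤ (∫ z, ‖u t z - u₀ t z‖ ^ 2) + Torus.gradNormSq (fun z => u t z - u₀ t z) :=
          le_add_of_nonneg_right (Torus.gradNormSq_nonneg _)
      _ ≤ CV * ((∫ z, ‖u 0 z - u₀ 0 z‖ ^ 2) + Torus.gradNormSq (fun z => u 0 z - u₀ 0 z)) := hV
      _ ≤ max CV 0 * ((∫ z, ‖u 0 z - u₀ 0 z‖ ^ 2) + Torus.gradNormSq (fun z => u 0 z - u₀ 0 z)) :=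
          mul_le_mul_of_nonneg_right (le_max_left _ _) hnn
      _ ≤ max CV 0 * (‖x - x₀‖ ^ 2 + L * ‖x - x₀‖) :=
          mul_le_mul_of_nonneg_left (by rw [e0]; exact add_le_add le_rfl hg) (le_max_right _ _)
  -- (II) continuity in time at `x₀`
  have hII : Tendsto (fun t => Φ t x₀) (𝓝[Ici 0] t₀) (𝓝 (Φ t₀ x₀)) :=
    hu₀.tendsto_state_nhdsWithin (Φx := fun t => Φ t x₀) (fun t ht => hΦ x₀ hx₀ u₀ p₀ hu₀ hx₀rep t ht) ht₀
  -- assembly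
  show ContinuousWithinAt (fun q : ℝ × Torus.energySpace d => Φ q.1 q.2) (Ici 0 ×ˢ K₁) (t₀, x₀)
  rw [ContinuousWithinAt, tendsto_iff_norm_sub_tendsto_zero]
  refine squeeze_zero' (Eventually.of_forall fun q => norm_nonneg _)
    (g := fun q : ℝ × Torus.energySpace d =>
      Real.sqrt (max CV 0 * (‖q.2 - x₀‖ ^ 2 + L * ‖q.2 - x₀‖)) + ‖Φ q.1 x₀ - Φ t₀ x₀‖) ?_ ?_
  · have hev : ∀ᶠ q : ℝ × Torus.energySpace d in 𝓝[Ici 0 ×ˢ K₁] (t₀, x₀), q ∈ Ici 0 ×ˢ K₁ ∧ q.1 < T := by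
      refine eventually_mem_nhdsWithin.and ?_
      have h : ∀ᶠ q : ℝ × Torus.energySpace d in 𝓝 (t₀, x₀), q.1 < T :=
        (continuous_fst.tendsto (t₀, x₀)).eventually (Iio_mem_nhds (by rw [hT_def]; linarith))
      exact h.filter_mono nhdsWithin_le_nhds
    filter_upwards [hev] with q hq
    obtain ⟨⟨hq1, hq2⟩, hqT⟩ := hq
    have h1 : ‖Φ q.1 q.2 - Φ q.1 x₀‖ ≤ Real.sqrt (max CV 0 * (‖q.2 - x₀‖ ^ 2 + L * ‖q.2 - x₀‖)) := by
      rw [← Real.sqrt_sq (norm_nonneg (Φ q.1 q.2 - Φ q.1 x₀))]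
      exact Real.sqrt_le_sqrt (hI q.2 hq2 q.1 ⟨mem_Ici.1 hq1, by linarith⟩)
    calc ‖Φ q.1 q.2 - Φ t₀ x₀‖ ≤ ‖Φ q.1 q.2 - Φ q.1 x₀‖ + ‖Φ q.1 x₀ - Φ t₀ x₀‖ :=
          norm_sub_le_norm_sub_add_norm_sub _ _ _
      _ ≤ Real.sqrt (max CV 0 * (‖q.2 - x₀‖ ^ 2 + L * ‖q.2 - x₀‖)) + ‖Φ q.1 x₀ - Φ t₀ x₀‖ :=
          add_le_add h1 le_rfl
  · have h1 : Tendsto (fun q : ℝ × Torus.energySpace d => Real.sqrt (max CV 0 * (‖q.2 - x₀‖ ^ 2 + L * ‖q.2 - x₀‖)))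
        (𝓝[Ici 0 ×ˢ K₁] (t₀, x₀)) (𝓝 0) := by
      have hc : Continuous fun q : ℝ × Torus.energySpace d =>
          Real.sqrt (max CV 0 * (‖q.2 - x₀‖ ^ 2 + L * ‖q.2 - x₀‖)) :=
        Real.continuous_sqrt.comp (continuous_const.mul (((continuous_snd.sub continuous_const).norm.pow 2).add
          (continuous_const.mul (continuous_snd.sub continuous_const).norm)))
      have h := hc.tendsto (t₀, x₀)
      simp only [sub_self, norm_zero, mul_zero, Real.sqrt_zero, ne_eq, OfNat.ofNat_ne_zero, not_false_eq_true,
        zero_pow, add_zero] at h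
      exact h.mono_left nhdsWithin_le_nhds
    have h2 : Tendsto (fun q : ℝ × Torus.energySpace d => ‖Φ q.1 x₀ - Φ t₀ x₀‖) (𝓝[Ici 0 ×ˢ K₁] (t₀, x₀)) (𝓝 0) := by
      have hfst : Tendsto (fun q : ℝ × Torus.energySpace d => q.1) (𝓝[Ici 0 ×ˢ K₁] (t₀, x₀)) (𝓝[Ici 0] t₀) := by
        rw [nhdsWithin_prod_eq]
        exact Filter.tendsto_fst
      have h := hII.comp hfst
      rw [tendsto_iff_norm_sub_tendsto_zero] at h
      exact h
    simpa using h1.add h2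

end TrajectorySet

end Literature.Analysis.FluidPDE

end
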